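import Summits.BirchSwinnertonDyer.BirchSwinnertonDyer.Theorems.PrintCf2RubinValueTwoKatzMeasureJZeroFrameSeven
import Summits.BirchSwinnertonDyer.BirchSwinnertonDyer.Theorems.PrintCf2RubinValueTwoKatzMeasureJZeroReadingConjugacy
import Literature.NumberTheory.EllipticCurves.X049FormalGroupLubinTateTwo
import HarnessLib

/-!
# The lane's `ℤ₂`-datum of `W = [1,−1,0,−2,−1]` FROM THE FRAME ([I2] FILE-4, piece (a))

Cell `bsd-print-cf2`, LEAD seat `bsd-line-cf2-p1` g20, crux `stmt-BirchSwinnertonDyer-20368` (`PrintCf2.SplitBadTwoRankOneOfFacts`),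
registered skeleton v14.10, BRIDGE stub `stub_perLevelBridge_two` (= `P1`).  The per-level socket `forall_label_moment_eq_at_level`
(FILE-3b, -w8 g14) and every file of the (e)-lane take the Lubin–Tate presentation of the formal group of `49a1 ⊗ ℤ₂` as HYPOTHESES
`{c P} hPexp hA hPlt heπ hc hV {ϖ} hp hϖ`; this file PRODUCES them from the frame at `v` (`v = (α₀) ∣ 2` of degree one,
`α₀² − α₀ + 2 = 0`, local uniformiser `u·2 = α₀`): `c = 1 − ϖ = e(u·2) = α₀` read `2`-adically, `ϖ ∈ ℤ₂ˣ` the unit root of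
`T² − T + 2`, `P = [c] = exp_W(c·log_W) ∈ 𝔉_c` and `Ŵ = F_P` (`cm7Padic_exists_formalGroupLaw_eq_ltF`, de Shalit II.1.10), `2 = ϖ·c`.

Main result ★ `exists_ltDatum_of_frame`.  THEOREMS ONLY; nothing is closed; no summit statement is proved by this seat; BSD is not
proved by any of this.

References: [deShalit1987] E. de Shalit, *Iwasawa theory of elliptic curves with complex multiplication* (1987), II §1.10 Lemma,
II §4.1; [Perrinriou1984] B. Perrin-Riou, *Arithmétique des courbes elliptiques et théorie d'Iwasawa*, Mém. SMF 17 (1984), Ch. III §1.2.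
-/

-- the summit namespace `Summit.BirchSwinnertonDyer.BirchSwinnertonDyer` repeats the problem name by design (D-0017)
set_option linter.dupNamespace false
set_option autoImplicit false

noncomputable section

open scoped Classical
open scoped NumberField
open PowerSeries IsDedekindDomain NumberField ValuativeRel
open Literature.NumberTheory.NumberFields Literature.NumberTheory.EllipticCurves
open Literature.NumberTheory.GaloisRepresentations Literature.NumberTheory.GaloisRepresentations.LubinTate
open _root_.WeierstrassCurve

namespace Summit.BirchSwinnertonDyer.BirchSwinnertonDyer.Theorems.PrintCf2.KatzMeasureJZeroSeam

variable {K : Type} [Field K] [NumberField K]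

/-- `[1,−1,0,−2,−1]` over `ℤ`, base-changed to `ℤ₂`, is the literal `ℤ₂`-model. [cite: deShalit1987, II §1.10 Lemma] -/
theorem cm7Int_map_castRingHom_padicInt :
    ((⟨1, -1, 0, -2, -1⟩ : WeierstrassCurve ℤ)).map (Int.castRingHom ℤ_[2]) = (⟨1, -1, 0, -2, -1⟩ : WeierstrassCurve ℤ_[2]) := by
  ext <;> simp [WeierstrassCurve.map]

/-- The local generator `w = u·2` (with `w = α₀` in `K_v`) satisfies `w² − w + 2 = 0` in `𝒪[K_v]`. [cite: deShalit1987, II §4.1] -/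
theorem sq_sub_self_add_two_of_coe_eq {v : HeightOneSpectrum (𝓞 K)} {α₀ : 𝓞 K} (hα₀ : α₀ ^ 2 - α₀ + 2 = 0)
    {w : 𝒪[v.adicCompletion K]} (hw : ((w : 𝒪[v.adicCompletion K]) : v.adicCompletion K) = ((α₀ : K) : v.adicCompletion K)) :
    w ^ 2 - w + 2 = 0 := by
  have h1 : ((α₀ : K)) ^ 2 - (α₀ : K) + 2 = 0 := by
    have := congrArg ((↑) : 𝓞 K → K) hα₀
    push_cast at this
    exact this
  have h2 : (algebraMap K (v.adicCompletion K) (α₀ : K)) ^ 2 - algebraMap K (v.adicCompletion K) (α₀ : K) + 2 = 0 := by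
    have := congrArg (algebraMap K (v.adicCompletion K)) h1
    simpa only [map_add, map_sub, map_pow, map_ofNat, map_zero] using this
  have h3 : ((w ^ 2 - w + 2 : 𝒪[v.adicCompletion K]) : v.adicCompletion K) = 0 := by
    push_cast
    rw [hw]
    exact h2
  exact_mod_cast h3

set_option maxHeartbeats 800000 in
/-- ★ **The `ℤ₂`-datum of the frame.**  For `v ∣ 2` of degree one (`he`, `hf`), `v = (α₀)` with `α₀² − α₀ + 2 = 0` and the local
uniformiser `u·2 = α₀` (`hu`): there are `c, ϖ ∈ ℤ₂`, a series `P ∈ ℤ₂⟦X⟧` and the Lubin–Tate structure proofs `hA : IsLTRing c 2`,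
`hPlt : IsLTSeries c 2 P` with `P ↦ exp_W(c·log_W)` (`hPexp`), `e(u·2) = c` for `e = 𝒪_v ≅ ℤ₂` (`heπ`), `α₀ ↦ c` under
`K_v ≅ ℚ₂` (`hc`), `(W ⊗ ℤ₂)^ = F_P` (`hV`), `2 = ϖ·c` (`hp`) and `ϖ ∈ ℤ₂ˣ` (`hϖ`) — the binders of
`KatzMeasureJZeroSeam.forall_label_moment_eq_at_level`, in its order. [cite: deShalit1987, II §1.10 Lemma, II §4.1]
[cite: Perrinriou1984, Ch. III §1.2] -/
theorem exists_ltDatum_of_frame (v : HeightOneSpectrum (𝓞 K)) [v.asIdeal.LiesOver (ratPlace 2).asIdeal]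
    (he : v.asIdeal.ramificationIdx (𝓞 ℚ) = 1) (hf : v.asIdeal.inertiaDeg (𝓞 ℚ) = 1)
    {α₀ : 𝓞 K} (hα₀ : α₀ ^ 2 - α₀ + 2 = 0)
    (u : 𝒪[v.adicCompletion K]ˣ)
    (hu : ((((u : 𝒪[v.adicCompletion K]) * ((2 : ℕ) : 𝒪[v.adicCompletion K]) : 𝒪[v.adicCompletion K]) : v.adicCompletion K)) =
      ((α₀ : K) : v.adicCompletion K)) :
    ∃ (c ϖ : ℤ_[2]) (P : PowerSeries ℤ_[2]) (hA : IsLTRing c 2) (hPlt : IsLTSeries c 2 P),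
      P.map PadicInt.Coe.ringHom = ((⟨1, -1, 0, -2, -1⟩ : WeierstrassCurve ℤ_[2]).map PadicInt.Coe.ringHom).formalExp.subst
        (C (c : ℚ_[2]) * ((⟨1, -1, 0, -2, -1⟩ : WeierstrassCurve ℤ_[2]).map PadicInt.Coe.ringHom).formalLog) ∧
      ((integerEquivAdicCompletionIntegers v).trans (padicIntEquivOfDegreeOne K 2 v he hf))
        ((u : 𝒪[v.adicCompletion K]) * ((2 : ℕ) : 𝒪[v.adicCompletion K])) = c ∧
      padicEquivOfDegreeOne K 2 v he hf (algebraMap K (v.adicCompletion K) (α₀ : K)) = c ∧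
      (((⟨1, -1, 0, -2, -1⟩ : WeierstrassCurve ℤ)).map (Int.castRingHom ℤ_[2])).formalGroupLaw = ltF hA hPlt ∧
      ((2 : ℕ) : ℤ_[2]) = ϖ * c ∧ IsUnit ϖ := by
  set e := (integerEquivAdicCompletionIntegers v).trans (padicIntEquivOfDegreeOne K 2 v he hf) with he_def
  -- the unit root `ϖ` with `e(u·2) = 1 − ϖ`
  have hw2 : ((u : 𝒪[v.adicCompletion K]) * ((2 : ℕ) : 𝒪[v.adicCompletion K])) ^ 2 -
      ((u : 𝒪[v.adicCompletion K]) * ((2 : ℕ) : 𝒪[v.adicCompletion K])) + 2 = 0 :=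
    sq_sub_self_add_two_of_coe_eq hα₀ hu
  obtain ⟨ϖ, hϖ, hroot, hew⟩ := KatzMeasureJZeroTop.exists_isUnit_root_two_of_map e.toRingHom (u : 𝒪[v.adicCompletion K])
    (w := (u : 𝒪[v.adicCompletion K]) * ((2 : ℕ) : 𝒪[v.adicCompletion K])) (by push_cast; ring) hw2
  have hroot' : ϖ ^ 2 - (Literature.NumberTheory.EllipticCurves.HasseManin.tr ((⟨1, -1, 0, -2, -1⟩ : WeierstrassCurve ℤ_[2]).map
      PadicInt.toZMod) : ℤ_[2]) * ϖ + (2 : ℕ) = 0 := by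
    rw [cm7Padic_tr_two]; exact hroot
  -- de Shalit II.1.10: `P = [1 − ϖ]`, `Ŵ = F_P`
  obtain ⟨P, hP, hPlt, hF⟩ := cm7Padic_exists_formalGroupLaw_eq_ltF hϖ hroot'
  have htr : ((Literature.NumberTheory.EllipticCurves.HasseManin.tr ((⟨1, -1, 0, -2, -1⟩ : WeierstrassCurve ℤ_[2]).map
      PadicInt.toZMod) : ℤ_[2]) - ϖ) = ((1 : ℤ) : ℤ_[2]) - ϖ := by rw [cm7Padic_tr_two]
  refine ⟨_, ϖ, P, isLTRing_of_root (p := 2) hϖ hroot', hPlt, hP, ?_, ?_, ?_, ?_, hϖ⟩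
  · -- `heπ`
    rw [htr, ← hew]; rfl
  · -- `hc`: `α₀ = u·2` in `K_v`, an integer, read through `𝒪_v ≅ ℤ₂ ⊂ ℚ₂`
    have h1 : algebraMap K (v.adicCompletion K) (α₀ : K) =
        ((integerEquivAdicCompletionIntegers v ((u : 𝒪[v.adicCompletion K]) * ((2 : ℕ) : 𝒪[v.adicCompletion K])) :
          v.adicCompletionIntegers K) : v.adicCompletion K) := by
      rw [coe_integerEquivAdicCompletionIntegers]; exact hu.symm
    rw [h1, ← coe_padicIntEquivOfDegreeOne_apply, htr, ← hew]
    rfl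
  · -- `hV`
    rw [cm7Int_map_castRingHom_padicInt]; exact hF
  · -- `hp`: `2 = ϖ·(1 − ϖ)`
    rw [mul_comm]; exact (sub_mul_eq_natCast_of_root hroot').symm

end Summit.BirchSwinnertonDyer.BirchSwinnertonDyer.Theorems.PrintCf2.KatzMeasureJZeroSeam

end
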